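import Literature.IUT.HodgeTheaters.TemperedCoveringsCor23viGraphIncidence
import Literature.IUT.HodgeTheaters.TemperedCoveringsCor23viHatCuspIncidenceReduction
import Literature.AnabelianGeometry.SemiGraphs.TemperedSpecialFibreTowerPiDataCuspEdges
import Literature.AnabelianGeometry.SemiGraphs.TemperedEdgeLikeIncomparable
import HarnessLib

/-!
# [IUTchI] Cor. 2.3 (vi) at the genuine 𝔛-datum over the origin datum `PiData.CuspOpenEdgeDict`: the base cusp
# incidence and the cusp ↦ open-edge dictionary BY NAME; the node rests on the pro-`Σ̂` cusp incidence `hFcusp` alone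

S. Mochizuki, *Inter-universal Teichmüller theory I*, kurims manuscript (May 2020), §2, Cor. 2.3 (vi) p. 48, proof p. 49
l. 62–64 [cite: Mochizuki2012, Cor 2.3(vi) pp.48-49] (D-0012 claim key; nothing of the series is asserted here);
S. Mochizuki, *Semi-graphs of anabelioids*, Publ. RIMS **42** (2006), Ex. 3.10 p. 44 (cusps of `X_K` = open edges of
`G^c`), Thm. 3.7 (ii)(iii) pp. 40–41, §6 p. 71 [cite: MochizukiSemiAnbd2006, Ex 3.10 p.44].

PROOF-ONLY knit (abc-iut cell, seat abc-iut-L5-d5 gen 8; cone row `IUTchI:Cor2.3(vi)`; no definition, no instance, no new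
`Prop` fact).  abc-iut-L3's origin datum `SpecialFibreTower.PiData.CuspOpenEdgeDict` (policy-D successor of `PiData`,
`TemperedSpecialFibreTowerPiDataCuspEdges.lean`: for every cusp `x` a branch of `𝔾^c` at the record's vertex of `ξ_x` whose
edge `e_x` is open and carries `J_x = S.admissible(I_x ∩ Δ)` as an edge-like subgroup) is CONSUMED BY NAME as the single
displayed hypothesis `(hdict : P.CuspOpenEdgeDict)`; from it:
* `hcusp_of_cuspOpenEdgeDict` — GAP G-w4d070-g11-1 (abc-iut-w4-d070's binder `hcusp`) is the datum's
  `CuspOpenEdgeDict.inertia_le_verticial_base`;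
* `cor23vi_ofSpecialFibre_closureH_of_piData_of_hatCuspIncidence_of_cuspOpenEdgeDict` — abc-iut-w4-d059's one-call closer
  (p493690) with its binder `hdictO := hdict.atLevel i`: row `IUTchI:Cor2.3(vi)` over the origin record, print's vertex atom,
  rests on the pro-`Σ̂` CUSP–subgraph incidence `hFcusp` (FACT-candidate G-w4d059-g8-1, open-edge case) ALONE;
* `verticialOver_iff_vtx_mem_of_cuspOpenEdgeDict` — granted `J_x ≠ 1`, print's vertex atom "`(P.proj i)(P.vtxOfCusp i x) ∈ ℍ`"
  and abc-iut-L5-d5's group atom "`J_x` verticial over `ℍ`" (p493882) COINCIDE (`verticialOver_iff_vtx_mem_of_openEdgeLike`: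
  Thm. 3.7 (ii)(iii) + `EdgeLikeDistinct` at the finite fibre `P.finite`), so the two closers of record agree.

BINDER CENSUS: `hdict : P.CuspOpenEdgeDict` ORIGIN (displayed record datum, policy D) · `hFcusp` FACT-CANDIDATE (G-w4d059-g8-1)
· `hJ1 : J_x ≠ ⊥` DATUM-INTERNAL (only in the agreement lemma) · LAW 0.  Model-RELATIVE (the genuine datum `ofSpecialFibre`);
an origin datum is a hypothesis asserted for no curve; typed ≠ discharged for the [IUTchI] claim keys; nothing here bears
on [IUTchIII] Cor. 3.12 or asserts that abc is proved or refuted.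
-/

noncomputable section

namespace Literature.IUT.HodgeTheaters

open _root_.Topology
open scoped Pointwise
open Literature.AnabelianGeometry.SemiGraphs
open Literature.AnabelianGeometry.SemiGraphs.ProfiniteSemiGraph

namespace StableCurveTemperedData

variable {p : ℕ} [Fact p.Prime] (X : TemperedCurve p) (d : X.GroupLevelData)
  (S : SpecialFibreData (X.toTemperedArithmeticGroup d)) (h36 : S.Gc.Prop36Hypotheses)
  (Sigma SigmaHat : Set ℕ) (hsub : Sigma ⊆ SigmaHat) (hne : Sigma.Nonempty)
  (hprime : ∀ q ∈ SigmaHat, q.Prime) (hp : p ∉ Sigma)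
  (TpH : Subgroup S.chart.G)
  {T : SpecialFibreTower X.DeltaTemp} (P : SpecialFibreTower.PiData X d S T)

/-- **GAP G-w4d070-g11-1 BY NAME**: over the origin datum `P.CuspOpenEdgeDict`, abc-iut-w4-d070's binder `hcusp` (base cusp
incidence at the record's vertex of `ξ_x`, any level `i`) is the datum's `inertia_le_verticial_base`.
[cite: MochizukiSemiAnbd2006, Thm 3.7(iii) p.41] -/
theorem hcusp_of_cuspOpenEdgeDict (hdict : P.CuspOpenEdgeDict) (i : ℕ) :
    ∀ x : {x : X.Pt // X.IsCusp x}, ∃ K ∈ verticialSubgroups S.chart ((P.proj i).vertexMap (P.vtxOfCusp i x)),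
      ((X.inertia x.1).subgroupOf (X.toTemperedArithmeticGroup d).delta).map S.admissible.toMonoidHom ≤ K :=
  hdict.inertia_le_verticial_base i

/-- **Row `IUTchI:Cor2.3(vi)` over the origin record with the cusp dictionary BY NAME** (`ℍ := P.H`, any
`Π^tp_ℍ := TpH ∈ decompSubgroups S.chart P.H`, print's `Π̂_ℍ`, print's vertex atom, any level `i`): abc-iut-w4-d059's one-call
closer fed with `hdictO := hdict.atLevel i` — the ONLY undischarged binder is the pro-`Σ̂` cusp–subgraph incidence `hFcusp`
(FACT-candidate G-w4d059-g8-1, open edges).  FQ type per the gate rule.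
[cite: Mochizuki2012, Cor 2.3(vi) pp.48-49] [claim: Mochizuki2012, status: disputed] -/
theorem cor23vi_ofSpecialFibre_closureH_of_piData_of_hatCuspIncidence_of_cuspOpenEdgeDict (hdict : P.CuspOpenEdgeDict)
    (i : ℕ) (hTpH : TpH ∈ S.chart.decompSubgroups P.H)
    (hFcusp : ∀ (e : S.Gc.graph.Edge),
      (∃ b₀ : S.Gc.graph.Branch, S.Gc.graph.edgeOf b₀ = e ∧ S.Gc.graph.abuts b₀ = none) →
      ∀ L ∈ edgeLikeSubgroups S.chart e,
      ∀ g : (TemperedGraphGroupData.exists_completion_of_prop36 S.Gc h36 S.chart).choose,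
        L.map (TemperedGraphGroupData.exists_completion_of_prop36 S.Gc h36 S.chart).choose_spec.choose.toMonoidHom ≤
          MulAut.conj g • (TpH.map (TemperedGraphGroupData.exists_completion_of_prop36 S.Gc h36
            S.chart).choose_spec.choose.toMonoidHom).topologicalClosure →
        ∃ b : S.Gc.graph.Branch, S.Gc.graph.edgeOf b = e ∧ ∃ w ∈ P.H.verts, S.Gc.graph.abuts b = some w) :
    Literature.IUT.HodgeTheaters.StableCurveTemperedData.Cor23vi
        (ofSpecialFibre X d S h36 Sigma SigmaHat hsub hne hprime hp TpH ((TpH.map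
          (TemperedGraphGroupData.exists_completion_of_prop36 S.Gc h36 S.chart).choose_spec.choose.toMonoidHom
          ).topologicalClosure) (Subgroup.le_topologicalClosure _)
          (fun x => (P.proj i).vertexMap (P.vtxOfCusp i x) ∈ P.H.verts)) :=
  cor23vi_ofSpecialFibre_closureH_of_piData_of_hatCuspIncidence X d S h36 Sigma SigmaHat hsub hne hprime hp TpH P i hTpH
    hFcusp (hdict.atLevel i)

/-- **The two (vi)(b) atoms of record COINCIDE over the dictionary** (granted `J_x ≠ 1`; finite fibre `P.finite`): print's vertex
atom "`(P.proj i)(P.vtxOfCusp i x) ∈ ℍ`" ⟺ the group atom "`J_x` is verticial at a vertex of `ℍ`" — so abc-iut-w4-d070's /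
abc-iut-w4-d059's closers and abc-iut-L5-d5's `cor23vi_ofSpecialFibre_verticialOver_*` are closers of the SAME instance.
[cite: MochizukiSemiAnbd2006, Thm 3.7(iii) p.41] -/
theorem verticialOver_iff_vtx_mem_of_cuspOpenEdgeDict (hdict : P.CuspOpenEdgeDict) (i : ℕ)
    (hJ1 : ∀ x : {x : X.Pt // X.IsCusp x},
      ((X.inertia x.1).subgroupOf (X.toTemperedArithmeticGroup d).delta).map S.admissible.toMonoidHom ≠ ⊥)
    {H : S.Gc.graph.Subgraph} (x : {x : X.Pt // X.IsCusp x}) :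
    (∃ v ∈ H.verts, ∃ K ∈ verticialSubgroups S.chart v,
      ((X.inertia x.1).subgroupOf (X.toTemperedArithmeticGroup d).delta).map S.admissible.toMonoidHom ≤ K) ↔
      (P.proj i).vertexMap (P.vtxOfCusp i x) ∈ H.verts := by
  obtain ⟨b, hb, hother, hJ⟩ := hdict.atLevel i x
  exact verticialOver_iff_vtx_mem_of_openEdgeLike X d S (fun x => (P.proj i).vertexMap (P.vtxOfCusp i x))
    P.finite.finite_vertex_base P.finite.finite_edge_base x (hdict.inertia_le_verticial_base i x)
    ⟨_, SpecialFibreTower.PiData.CuspOpenEdgeDict.not_isClosedEdge hother, hJ⟩ (hJ1 x)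

/-! ### v2 (append-only): `J_x ≠ 1` is AUTOMATIC under the dictionary -/

/-- **Under the dictionary the cuspidal subgroup `J_x` is nontrivial** — it is an edge-like subgroup, and edge-like
subgroups of `π₁^temp(G^c)` are infinite under the hypotheses of [SemiAnbd] Thm. 3.7 (Cor. 3.9 p. 42: `L ≅ Π_b` through an
injective verticial homomorphism; abc-iut-L3's `ne_bot_of_mem_edgeLikeSubgroups` with `verticialInjective_holds`).  So the
binder `hJ1` of `verticialOver_iff_vtx_mem_of_cuspOpenEdgeDict` is dischargeable BY NAME.
[cite: MochizukiSemiAnbd2006, Cor 3.9 p.42] -/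
theorem cuspImage_ne_bot_of_cuspOpenEdgeDict (hdict : P.CuspOpenEdgeDict) (x : {x : X.Pt // X.IsCusp x}) :
    ((X.inertia x.1).subgroupOf (X.toTemperedArithmeticGroup d).delta).map S.admissible.toMonoidHom ≠ ⊥ := by
  obtain ⟨b, -, -, hJ⟩ := hdict x
  exact ne_bot_of_mem_edgeLikeSubgroups verticialInjective_holds S.hyp S.chart hJ

/-- **The two (vi)(b) atoms COINCIDE over the dictionary, with NO further binder** (v2 of
`verticialOver_iff_vtx_mem_of_cuspOpenEdgeDict`: `J_x ≠ 1` supplied by `cuspImage_ne_bot_of_cuspOpenEdgeDict`).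
[cite: MochizukiSemiAnbd2006, Thm 3.7(iii) p.41] -/
theorem verticialOver_iff_vtx_mem_of_cuspOpenEdgeDict' (hdict : P.CuspOpenEdgeDict) (i : ℕ)
    {H : S.Gc.graph.Subgraph} (x : {x : X.Pt // X.IsCusp x}) :
    (∃ v ∈ H.verts, ∃ K ∈ verticialSubgroups S.chart v,
      ((X.inertia x.1).subgroupOf (X.toTemperedArithmeticGroup d).delta).map S.admissible.toMonoidHom ≤ K) ↔
      (P.proj i).vertexMap (P.vtxOfCusp i x) ∈ H.verts :=
  verticialOver_iff_vtx_mem_of_cuspOpenEdgeDict X d S P hdict i (cuspImage_ne_bot_of_cuspOpenEdgeDict X d S P hdict) x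

end StableCurveTemperedData

end Literature.IUT.HodgeTheaters

end
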